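import Summits.KontsevichZagierPeriods.Zeta5Search.Barrier.ConeGammaCritFarSound

/-!
# ζ(5) search — BARRIER: THE FAR CRITICAL POINT THROUGH INFINITY — soundness II (`X = N(z)/Q(z)` at the far root; the
# far value in affine arithmetic)

HONEST FRAMING (cell `pub-zeta5`): systematic search; no irrationality claim unless kernel-certified. Real polynomial
algebra and affine-arithmetic membership lemmas for the checker `ConeGammaCritFar` about BZ's §5 critical system
(MODEL objects under BZ (28)+(30), [BZ22] = arXiv:2210.03391); nothing about any γ of record, the cone's supremum (C2
OPEN), S-E (CONJECTURED) or `ζ(5)`. Theory seat cert-2 g38.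

* `xNum`, `xDen` (real forms of the checker's `xNumDen`), `cubicQ_eq` (`Q(Y) = Y²·xDen(1/Y)`: the `Y³` terms of `Q`
  cancel) and **`x_eq_of_root`** — at a root with `Q(Y) ≠ 0`, `Y ≠ 0`: `−Y + (s₆−s₀)·P(Y)/Q(Y) = xNum(1/Y)/xDen(1/Y)`
  (the `Y³` terms of `X·Q(Y) = −Y·Q + (s₆−s₀)·P` cancel identically) — the named «X-identity at the far root»;
* `xNumDen_mem`, `xhatAF_mem` (with `xDen ≠ 0`, indeed `< 0`), `farSum`, **`farValueAF_sound`** — the far value form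
  encloses the far-chart sum at `(xNum/xDen, z)` (g37's `logSum_mem`, `argsFar_forall₂`), every numerator non-zero.
-/

noncomputable section

open Set

namespace Summit.KontsevichZagierPeriods.Zeta5Search.Barrier.ConeGamma

namespace CritFar

open Literature.Analysis.ValidatedNumerics (AForm)
open Literature.Analysis.ValidatedNumerics.AForm
open LemmaFBox (SC SC_pos)
open CritBox

/-! ### `X` at a root: the rational function in `z = 1/Y` -/

/-- Numerator `n₂ + n₁z + n₀z²` (see `xNumDen`; written in the term order of the affine composition). -/
def xNum (t : Fin 8 → ℝ) (z : ℝ) : ℝ :=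
  t 0 * t 6 + (t 1 * t 2 + t 1 * t 7 + t 2 * t 7)
    + (-(t 0 * t 6 * (t 1 + t 2 + t 7)) - t 1 * t 2 * t 7 + (t 6 - t 0) * (t 1 * t 2 + t 1 * t 7 + t 2 * t 7)) * z
    + -((t 6 - t 0) * (t 1 * t 2 * t 7)) * (z * z)

/-- Denominator `(t₆−t₀) + q₁z + q₀z²` (see `xNumDen`). -/
def xDen (t : Fin 8 → ℝ) (z : ℝ) : ℝ :=
  t 6 - t 0
    + ((t 1 + t 2 + t 7) * t 0 - t 6 * (t 1 + t 2 + t 7) - t 0 * t 6 - (t 1 * t 2 + t 1 * t 7 + t 2 * t 7)) * z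
    + (t 0 * t 6 * (t 1 + t 2 + t 7) + t 1 * t 2 * t 7) * (z * z)

/-- `Q(Y) = Y²·xDen(1/Y)` for `Y ≠ 0` (the `Y³` terms of `Q` cancel). -/
theorem cubicQ_eq (t : Fin 8 → ℝ) {Y : ℝ} (hY : Y ≠ 0) : cubicQ t Y = Y ^ 2 * xDen t Y⁻¹ := by
  unfold cubicQ cubicP xDen
  field_simp
  ring

/-- **`X` at a root**: for `Y ≠ 0` with `Q(Y) ≠ 0`, `xDen(1/Y) ≠ 0` and
`−Y + (t₆−t₀)·P(Y)/Q(Y) = xNum(1/Y)/xDen(1/Y)` (the `Y³` terms of `X·Q(Y) = −YQ + (t₆−t₀)P` cancel identically). -/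
theorem x_eq_of_root (t : Fin 8 → ℝ) {Y : ℝ} (hY : Y ≠ 0) (hQ : cubicQ t Y ≠ 0) :
    xDen t Y⁻¹ ≠ 0 ∧ -Y + (t 6 - t 0) * cubicP t Y / cubicQ t Y = xNum t Y⁻¹ / xDen t Y⁻¹ := by
  have hD : xDen t Y⁻¹ ≠ 0 := by
    intro h0
    apply hQ
    rw [cubicQ_eq t hY, h0, mul_zero]
  refine ⟨hD, ?_⟩
  have key : (-Y * cubicQ t Y + (t 6 - t 0) * cubicP t Y) * xDen t Y⁻¹ = xNum t Y⁻¹ * cubicQ t Y := by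
    simp only [cubicQ, cubicP, xNum, xDen]
    field_simp
    ring
  have e1 : -Y + (t 6 - t 0) * cubicP t Y / cubicQ t Y = (-Y * cubicQ t Y + (t 6 - t 0) * cubicP t Y) / cubicQ t Y := by
    field_simp
  rw [e1, div_eq_div_iff hQ hD]
  exact key

/-! ### Affine membership: `X = N/Q` and the far value -/

section Mem
variable {ε : ℕ → ℝ} {tA : Fin 8 → AForm} {t : Fin 8 → ℝ} {ZA : AForm} {z : ℝ}

/-- The numerator/denominator forms enclose `xNum`, `xDen`. -/
theorem xNumDen_mem (hε : Valid ε) (ht : ∀ i, mem SC ε (t i) (tA i)) (hz : mem SC ε z ZA) :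
    mem SC ε (xNum t z) (xNumDen tA ZA).1 ∧ mem SC ε (xDen t z) (xNumDen tA ZA).2 := by
  have m := fun {x y : ℝ} {F G : AForm} (hx : mem SC ε x F) (hy : mem SC ε y G) => mem_mul SC_pos hε hx hy
  have hsp := mem_add (mem_add (ht 1) (ht 2)) (ht 7)
  have he2 := mem_add (mem_add (m (ht 1) (ht 2)) (m (ht 1) (ht 7))) (m (ht 2) (ht 7))
  have he3 := m (m (ht 1) (ht 2)) (ht 7)
  have hd := mem_sub (ht 6) (ht 0)
  have h06 := m (ht 0) (ht 6)
  have hz2 := m hz hz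
  simp only [xNumDen]
  exact ⟨mem_add (mem_add (mem_add h06 he2) (m (mem_add (mem_sub (mem_neg (m h06 hsp)) he3) (m hd he2)) hz))
      (m (mem_neg (m hd he3)) hz2),
    mem_add (mem_add hd (m (mem_sub (mem_sub (mem_sub (m hsp (ht 0)) (m (ht 6) hsp)) h06) he2) hz))
      (m (mem_add (m h06 hsp) he3) hz2)⟩

/-- **`xhatAF` encloses `X = xNum/xDen`** and certifies `xDen ≠ 0` (indeed `xDen < 0`). -/
theorem xhatAF_mem (hε : Valid ε) (ht : ∀ i, mem SC ε (t i) (tA i)) (hz : mem SC ε z ZA) {XA : AForm}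
    (hX : xhatAF tA ZA = some XA) : xDen t z ≠ 0 ∧ mem SC ε (xNum t z / xDen t z) XA := by
  obtain ⟨hN, hDm⟩ := xNumDen_mem hε ht hz
  unfold xhatAF at hX
  split at hX
  · rename_i I hI
    simp only [Option.some.injEq] at hX
    subst hX
    have hneg := mem_neg hDm
    have hpos : 0 < -xDen t z := pos_of_rad_lt SC_pos hε (rad_lt_of_inv hI) hneg
    have hinv := mem_inv SC_pos hε hI hneg
    refine ⟨by linarith, ?_⟩
    have := mem_neg (mem_mul SC_pos hε hN hinv)
    have e : -(xNum t z * (-xDen t z)⁻¹) = xNum t z / xDen t z := by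
      rw [div_eq_mul_inv, inv_neg]; ring
    rwa [e] at this
  · exact absurd hX (by simp)

/-- The far-chart sum of the growth functional at `(X, z)` (g37's `growthLogR_far` right-hand side). -/
def farSum (t : Fin 8 → ℝ) (X z : ℝ) : ℝ :=
  ((((coefsR t).zip (argsFarR t X z)) ++ constTermsR t).map fun r => r.1 * Real.log |r.2|).sum

/-- **`farValueAF` is sound**: `xDen ≠ 0`, every far numerator at `(xNum/xDen, z)` is non-zero, and the far sum is
enclosed. -/
theorem farValueAF_sound (hε : Valid ε) (ht : ∀ i, mem SC ε (t i) (tA i)) (hz : mem SC ε z ZA) {G : AForm}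
    (hG : farValueAF tA ZA = some G) :
    xDen t z ≠ 0 ∧ (∀ r ∈ argsFarR t (xNum t z / xDen t z) z, r ≠ 0) ∧
      mem SC ε (farSum t (xNum t z / xDen t z) z) G := by
  unfold farValueAF at hG
  split at hG
  · rename_i XA hXA
    obtain ⟨hD, hX⟩ := xhatAF_mem hε ht hz hXA
    unfold valueAF at hG
    simp only [if_true] at hG
    have hF := forall₂_zip (coefs_forall₂ ht) (argsFar_forall₂ hε ht hX hz)
    have hall := List.rel_append hF (constTerms_forall₂ ht)
    obtain ⟨hne, hmem⟩ := logSum_mem hε _ _ hall hG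
    refine ⟨hD, ?_, hmem⟩
    intro r hr
    set X := xNum t z / xDen t z
    have hlen : (argsFarR t X z).length = 12 := by simp [argsFarR]
    have hlenc : (coefsR t).length = 12 := by simp [coefsR]
    obtain ⟨i, hi, hgi⟩ := List.getElem_of_mem hr
    have hzip : ((coefsR t)[i]'(by rw [hlenc]; rw [hlen] at hi; exact hi), (argsFarR t X z)[i]) ∈
        ((coefsR t).zip (argsFarR t X z)) ++ constTermsR t := by
      apply List.mem_append_left
      rw [List.mem_iff_getElem]
      refine ⟨i, by simp [hlenc, hlen]; rw [hlen] at hi; exact hi, ?_⟩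
      simp
    have := hne _ hzip
    simpa [hgi] using this
  · exact absurd hG (by simp)

end Mem

end CritFar

end Summit.KontsevichZagierPeriods.Zeta5Search.Barrier.ConeGamma

end
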